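import Literature.NumberTheory.Automorphic.UnitaryGroupTruncatedKernelHighCusp
import HarnessLib

/-!
# The difference of two truncated kernels on `U(3)`: `k^{T'}(x) − k^{T}(x)` is the pseudo-Eisenstein
# series of the WINDOW `1_{T < H ≤ T'} K_B` (first step of «`J^T(f)` is a polynomial in `log T`»)
(Rogawski, *Automorphic Representations of Unitary Groups in Three Variables* (1990), §2.1 p. 12
«each term in (2.1.1) is a polynomial in `T`», §2.2 p. 13; Arthur, *The trace formula in invariant
form*, Ann. of Math. 114 (1981), Prop. 2.3 — the comparison of two truncations)

Topic `NumberTheory/Automorphic`; namespace `Literature.NumberTheory.Automorphic.UnitaryGroup`. THEOREMS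
ONLY over accepted tree modules: no definition, no named fact, no instance, no notation, no `sorry`.
Brick (L2-a) of the road to the T1-qs law ★ `UnitaryGroup.TruncatedTracePolynomial`
(`UnitaryGroupArthurTruncatedTrace`): integrating the identity below over `G(F)\G(𝔸_F)` and unfolding
the pseudo-Eisenstein series gives `J^{T'}(f) − J^{T}(f) = ∫_{B(F)\G(𝔸_F), T < H ≤ T'} K_B`, and the
`δ_B`-homogeneity ★ `kernelBorel_borel_mul_mul` of `K_B` makes that integral `C_f · (log T' − log T)`.

Letters (all ★ `UnitaryGroupArthurTruncatedKernel` / `UnitaryGroupBorelTruncation`): `K_B = kernelBorel ν 𝓕 f`,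
the cut-off tail `kernelBorelTail ν 𝓕 T f = 1_{T < H} K_B(·,·)`, `pseudoEisenstein ψ x = Σ_{δ ∈ B(F)\G(F)} ψ(δx)`,
`k^T = truncatedKernel ν 𝓕 T f = K(x,x) − pseudoEisenstein (kernelBorelTail …) x`, `H = borelHeight`.
The WINDOW is written `{y | T < H y ∧ H y ≤ T'}.indicator (fun y => K_B(y, y))` (no definition).

* §1 `kernelBorelTail_sub_kernelBorelTail` — `1_{T<H} K_B − 1_{T'<H} K_B = 1_{T<H≤T'} K_B` (`T ≤ T'`), and the
  left `B(F)`-invariance of the window (`window_rational_borel_mul`).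
* §2 the window's pseudo-Eisenstein series COLLAPSES (Siegel property ★
  `not_lt_borelHeight_mul_of_not_mem_arithmeticBorel`: for `1 ≤ T < H(g)` no non-Borel translate of `g` is
  above `T`): `pseudoEisenstein_window_eq_self` (`= window(g)` when `1 ≤ T < H(g)`),
  `pseudoEisenstein_window_eq_zero` (`= 0` when no translate of `x` is above `T`),
  `pseudoEisenstein_window_rational_mul` (left `G(F)`-invariance).
* §3 **`truncatedKernel_sub_truncatedKernel`** — for `1 ≤ T ≤ T'` and EVERY `x ∈ G(𝔸_F)`:
  `k^{T'}(x) − k^{T}(x) = Σ_{δ ∈ B(F)\G(F)} 1_{T < H(δx) ≤ T'} K_B(δx, δx)`;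
  `truncatedKernel_sub_truncatedKernel_eq_of_lt` (the value `K_B(γx, γx) · 1_{H(γx) ≤ T'}` at the unique
  class `γ` above `T`) and `truncatedKernel_sub_truncatedKernel_eq_zero` (no class above `T`).

## References

* J. D. Rogawski, *Automorphic Representations of Unitary Groups in Three Variables*, Annals of
  Mathematics Studies 123 (1990), §2.1 (p. 12), §2.2 (p. 13) [Rogawski1990].
* J. Arthur, *The trace formula in invariant form*, Ann. of Math. 114 (1981), §2 (Prop. 2.3)
  [Arthur1981TraceFormulaInvariantForm].
* S. Shokranian, *The Selberg–Arthur Trace Formula*, LNM 1503 (1992), Thm. (5.7), Rem. (5.8)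
  [Shokranian1992].
-/

set_option autoImplicit false

noncomputable section

open MeasureTheory Measure NumberField Set
open scoped NNReal

namespace Literature.NumberTheory.Automorphic

namespace UnitaryGroup

variable {F E : Type} [Field F] [NumberField F] [Field E] [NumberField E] [Algebra F E]
  {c : E ≃ₐ[F] E}

/-! ## §1 The window `1_{T < H ≤ T'} K_B` as a difference of two cut-off tails -/

section General

variable {N : ℕ} [NeZero N] [MeasurableSpace (adelicUnipotent F E c N)] [BorelSpace (adelicUnipotent F E c N)]

omit [BorelSpace (adelicUnipotent F E c N)] in
/-- **`1_{T<H(y)} K_B(y,y) − 1_{T'<H(y)} K_B(y,y) = 1_{T<H(y)≤T'} K_B(y,y)`** for `T ≤ T'` (three cases on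
`H(y)`). [cite: Rogawski1990, §2.2 (p. 13)] -/
theorem kernelBorelTail_sub_kernelBorelTail (ν : Measure (adelicUnipotent F E c N))
    (𝓕 : Set (adelicUnipotent F E c N)) (f : (quasiSplit F E c N).Adelic → ℂ) {T T' : ℝ≥0}
    (hTT' : T ≤ T') (y : (quasiSplit F E c N).Adelic) :
    kernelBorelTail ν 𝓕 T f y - kernelBorelTail ν 𝓕 T' f y =
      {y : (quasiSplit F E c N).Adelic | T < borelHeight y ∧ borelHeight y ≤ T'}.indicator
        (fun y => kernelBorel ν 𝓕 f y y) y := by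
  by_cases h1 : T < borelHeight y
  · by_cases h2 : T' < borelHeight y
    · rw [kernelBorelTail_of_lt f h1, kernelBorelTail_of_lt f h2, sub_self,
        Set.indicator_of_notMem (fun h => (not_le.2 h2) h.2)]
    · rw [kernelBorelTail_of_lt f h1, kernelBorelTail_of_not_lt f h2, sub_zero,
        Set.indicator_of_mem (show y ∈ {y : (quasiSplit F E c N).Adelic |
          T < borelHeight y ∧ borelHeight y ≤ T'} from ⟨h1, not_lt.1 h2⟩)]
  · have h2 : ¬T' < borelHeight y := fun h => h1 (lt_of_le_of_lt hTT' h)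
    rw [kernelBorelTail_of_not_lt f h1, kernelBorelTail_of_not_lt f h2, sub_zero,
      Set.indicator_of_notMem (fun h => h1 h.1)]

omit [BorelSpace (adelicUnipotent F E c N)] in
/-- The window vanishes where `¬ T < H(y)`. [cite: Rogawski1990, §2.2 (p. 13)] -/
theorem window_of_not_lt (ν : Measure (adelicUnipotent F E c N)) (𝓕 : Set (adelicUnipotent F E c N))
    (f : (quasiSplit F E c N).Adelic → ℂ) {T T' : ℝ≥0} {y : (quasiSplit F E c N).Adelic}
    (hy : ¬T < borelHeight y) :
    {y : (quasiSplit F E c N).Adelic | T < borelHeight y ∧ borelHeight y ≤ T'}.indicator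
        (fun y => kernelBorel ν 𝓕 f y y) y = 0 :=
  Set.indicator_of_notMem (fun h => hy h.1) _

omit [BorelSpace (adelicUnipotent F E c N)] in
/-- The window vanishes where `T' < H(y)`. [cite: Rogawski1990, §2.2 (p. 13)] -/
theorem window_of_lt (ν : Measure (adelicUnipotent F E c N)) (𝓕 : Set (adelicUnipotent F E c N))
    (f : (quasiSplit F E c N).Adelic → ℂ) {T T' : ℝ≥0} {y : (quasiSplit F E c N).Adelic}
    (hy : T' < borelHeight y) :
    {y : (quasiSplit F E c N).Adelic | T < borelHeight y ∧ borelHeight y ≤ T'}.indicator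
        (fun y => kernelBorel ν 𝓕 f y y) y = 0 :=
  Set.indicator_of_notMem (fun h => (not_le.2 hy) h.2) _

omit [BorelSpace (adelicUnipotent F E c N)] in
/-- The window is `K_B(y,y)` where `T < H(y) ≤ T'`. [cite: Rogawski1990, §2.2 (p. 13)] -/
theorem window_of_mem (ν : Measure (adelicUnipotent F E c N)) (𝓕 : Set (adelicUnipotent F E c N))
    (f : (quasiSplit F E c N).Adelic → ℂ) {T T' : ℝ≥0} {y : (quasiSplit F E c N).Adelic}
    (h1 : T < borelHeight y) (h2 : borelHeight y ≤ T') :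
    {y : (quasiSplit F E c N).Adelic | T < borelHeight y ∧ borelHeight y ≤ T'}.indicator
        (fun y => kernelBorel ν 𝓕 f y y) y = kernelBorel ν 𝓕 f y y :=
  Set.indicator_of_mem (show y ∈ {y : (quasiSplit F E c N).Adelic |
    T < borelHeight y ∧ borelHeight y ≤ T'} from ⟨h1, h2⟩) _

/-- **The window is left `B(F)`-invariant** (difference of two `B(F)`-invariant tails, ★
`kernelBorelTail_rational_borel_mul` over the `B(F)`-invariance of the diagonal of `K_B`, ★
`kernelBorel_diag_rational_borel_mul`). [cite: Rogawski1990, §2.2 (p. 13)] -/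
theorem window_rational_borel_mul (ν : Measure (adelicUnipotent F E c N)) [ν.IsHaarMeasure]
    {𝓕 : Set (adelicUnipotent F E c N)} (h𝓕 : IsFundamentalDomain (rationalUnipotent F E c N) 𝓕 ν)
    (f : (quasiSplit F E c N).Adelic → ℂ) {T T' : ℝ≥0} (hTT' : T ≤ T')
    (b : (quasiSplit F E c N).arithmeticSubgroup) (hb : b ∈ arithmeticBorel F E c N)
    (y : (quasiSplit F E c N).Adelic) :
    {y : (quasiSplit F E c N).Adelic | T < borelHeight y ∧ borelHeight y ≤ T'}.indicator
        (fun y => kernelBorel ν 𝓕 f y y) ((b : (quasiSplit F E c N).Adelic) * y) =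
      {y : (quasiSplit F E c N).Adelic | T < borelHeight y ∧ borelHeight y ≤ T'}.indicator
        (fun y => kernelBorel ν 𝓕 f y y) y := by
  rw [← kernelBorelTail_sub_kernelBorelTail ν 𝓕 f hTT', ← kernelBorelTail_sub_kernelBorelTail ν 𝓕 f hTT',
    kernelBorelTail_rational_borel_mul (kernelBorel_diag_rational_borel_mul ν h𝓕 f) T b hb y,
    kernelBorelTail_rational_borel_mul (kernelBorel_diag_rational_borel_mul ν h𝓕 f) T' b hb y]

end General

/-! ## §2 `N = 3`: the pseudo-Eisenstein series of the window collapses -/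

section Three

variable [MeasurableSpace (adelicUnipotent F E c 3)] [BorelSpace (adelicUnipotent F E c 3)]

/-- **The window's pseudo-Eisenstein series at a point high in the cusp**: for `1 ≤ T < H(g)`,
`Σ_{δ ∈ B(F)\G(F)} 1_{T<H(δg)≤T'} K_B(δg,δg) = 1_{H(g) ≤ T'} K_B(g, g)` — only `δ = 1` survives, since no
non-Borel translate of `g` is above `T` (★ `not_lt_borelHeight_mul_of_not_mem_arithmeticBorel`).
[cite: Rogawski1990, §2.2 (p. 13)] -/
theorem pseudoEisenstein_window_eq_self (ν : Measure (adelicUnipotent F E c 3)) [ν.IsHaarMeasure]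
    {𝓕 : Set (adelicUnipotent F E c 3)} (h𝓕 : IsFundamentalDomain (rationalUnipotent F E c 3) 𝓕 ν)
    (f : (quasiSplit F E c 3).Adelic → ℂ) {T T' : ℝ≥0} (hT : 1 ≤ T) (hTT' : T ≤ T')
    {g : (quasiSplit F E c 3).Adelic} (hg : T < borelHeight g) :
    pseudoEisenstein ({y : (quasiSplit F E c 3).Adelic | T < borelHeight y ∧ borelHeight y ≤ T'}.indicator
        (fun y => kernelBorel ν 𝓕 f y y)) g =
      {y : (quasiSplit F E c 3).Adelic | T < borelHeight y ∧ borelHeight y ≤ T'}.indicator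
        (fun y => kernelBorel ν 𝓕 f y y) g :=
  pseudoEisenstein_eq_self_of_forall_not_mem (window_rational_borel_mul ν h𝓕 f hTT') g
    (fun _ hγ => window_of_not_lt ν 𝓕 f (not_lt_borelHeight_mul_of_not_mem_arithmeticBorel hγ hT hg))

omit [BorelSpace (adelicUnipotent F E c 3)] in
/-- **The window's pseudo-Eisenstein series vanishes below the cusp**: if no translate `γ x`, `γ ∈ G(F)`,
is above `T`, every term vanishes. [cite: Rogawski1990, §2.2 (p. 13)] -/
theorem pseudoEisenstein_window_eq_zero (ν : Measure (adelicUnipotent F E c 3))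
    (𝓕 : Set (adelicUnipotent F E c 3)) (f : (quasiSplit F E c 3).Adelic → ℂ) {T T' : ℝ≥0}
    {x : (quasiSplit F E c 3).Adelic}
    (hx : ∀ γ : (quasiSplit F E c 3).arithmeticSubgroup,
      borelHeight ((γ : (quasiSplit F E c 3).Adelic) * x) ≤ T) :
    pseudoEisenstein ({y : (quasiSplit F E c 3).Adelic | T < borelHeight y ∧ borelHeight y ≤ T'}.indicator
        (fun y => kernelBorel ν 𝓕 f y y)) x = 0 := by
  rw [pseudoEisenstein_def]
  refine finsum_eq_zero_of_forall_eq_zero fun q => ?_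
  exact window_of_not_lt ν 𝓕 f (not_lt.2 (hx _))

/-- **The window's pseudo-Eisenstein series is left `G(F)`-invariant** (★ `pseudoEisenstein_rational_mul`).
[cite: Rogawski1990, §2.2 (p. 13)] -/
theorem pseudoEisenstein_window_rational_mul (ν : Measure (adelicUnipotent F E c 3)) [ν.IsHaarMeasure]
    {𝓕 : Set (adelicUnipotent F E c 3)} (h𝓕 : IsFundamentalDomain (rationalUnipotent F E c 3) 𝓕 ν)
    (f : (quasiSplit F E c 3).Adelic → ℂ) {T T' : ℝ≥0} (hTT' : T ≤ T')
    (γ : (quasiSplit F E c 3).arithmeticSubgroup) (x : (quasiSplit F E c 3).Adelic) :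
    pseudoEisenstein ({y : (quasiSplit F E c 3).Adelic | T < borelHeight y ∧ borelHeight y ≤ T'}.indicator
        (fun y => kernelBorel ν 𝓕 f y y)) ((γ : (quasiSplit F E c 3).Adelic) * x) =
      pseudoEisenstein ({y : (quasiSplit F E c 3).Adelic | T < borelHeight y ∧ borelHeight y ≤ T'}.indicator
        (fun y => kernelBorel ν 𝓕 f y y)) x :=
  pseudoEisenstein_rational_mul (window_rational_borel_mul ν h𝓕 f hTT') γ x

/-! ## §3 `k^{T'} − k^{T}` is the pseudo-Eisenstein series of the window -/

/-- **At a point with a translate above `T`**: if `1 ≤ T ≤ T'` and `T < H(γ x)` for some `γ ∈ G(F)`, then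
`k^{T'}(x) − k^{T}(x) = 1_{H(γx) ≤ T'} K_B(γx, γx)`: move to `g = γ x` by `G(F)`-invariance (★
`truncatedKernel_rational_mul`); there `k^T(g) = K(g,g) − K_B(g,g)` (★ `truncatedKernel_eq_kernel_sub_kernelBorel`),
and `k^{T'}(g)` is `K(g,g) − K_B(g,g)` if `T' < H(g)`, else `K(g,g)` (no translate of `g` is above `T'`:
the Borel ones have height `H(g) ≤ T'`, the others are not even above `T`). [cite: Rogawski1990, §2.2 (p. 13)] -/
theorem truncatedKernel_sub_truncatedKernel_eq_of_lt (ν : Measure (adelicUnipotent F E c 3))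
    [ν.IsHaarMeasure] {𝓕 : Set (adelicUnipotent F E c 3)}
    (h𝓕 : IsFundamentalDomain (rationalUnipotent F E c 3) 𝓕 ν) (f : (quasiSplit F E c 3).Adelic → ℂ)
    {T T' : ℝ≥0} (hT : 1 ≤ T) (hTT' : T ≤ T') {x : (quasiSplit F E c 3).Adelic}
    {γ : (quasiSplit F E c 3).arithmeticSubgroup} (hγ : T < borelHeight ((γ : (quasiSplit F E c 3).Adelic) * x)) :
    truncatedKernel ν 𝓕 T' f x - truncatedKernel ν 𝓕 T f x =
      {y : (quasiSplit F E c 3).Adelic | T < borelHeight y ∧ borelHeight y ≤ T'}.indicator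
        (fun y => kernelBorel ν 𝓕 f y y) ((γ : (quasiSplit F E c 3).Adelic) * x) := by
  have hK := kernelBorel_diag_rational_borel_mul ν h𝓕 f
  set g : (quasiSplit F E c 3).Adelic := (γ : (quasiSplit F E c 3).Adelic) * x with hg
  rw [← truncatedKernel_rational_mul hK T γ x, ← truncatedKernel_rational_mul hK T' γ x, ← hg,
    truncatedKernel_eq_kernel_sub_kernelBorel ν h𝓕 f hT hγ]
  by_cases h2 : T' < borelHeight g
  · rw [truncatedKernel_eq_kernel_sub_kernelBorel ν h𝓕 f (hT.trans hTT') h2, sub_self,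
      window_of_lt ν 𝓕 f h2]
  · -- no translate of `g` is above `T'`
    have hle : ∀ δ : (quasiSplit F E c 3).arithmeticSubgroup,
        borelHeight ((δ : (quasiSplit F E c 3).Adelic) * g) ≤ T' := by
      intro δ
      by_cases hδ : δ ∈ arithmeticBorel F E c 3
      · obtain ⟨γ', hγ'⟩ := δ.2
        have hγ'B : (quasiSplit F E c 3).toAdelic γ' ∈ borelAdelic F E c 3 := by
          rw [hγ']; exact (mem_arithmeticBorel_iff δ).1 hδ
        rw [← hγ', borelHeight_rational_borel_mul γ' hγ'B g]
        exact not_lt.1 h2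
      · exact (not_lt.1 (not_lt_borelHeight_mul_of_not_mem_arithmeticBorel hδ hT hγ)).trans hTT'
    rw [truncatedKernel_eq_kernel_of_forall_le f hle, sub_sub_cancel, window_of_mem ν 𝓕 f hγ (not_lt.1 h2)]

omit [BorelSpace (adelicUnipotent F E c 3)] in
/-- **At a point with no translate above `T`**: `k^{T'}(x) − k^{T}(x) = 0` (both equal `K(x,x)`, ★
`truncatedKernel_eq_kernel_of_forall_le`). [cite: Rogawski1990, §2.2 (p. 13)] -/
theorem truncatedKernel_sub_truncatedKernel_eq_zero (ν : Measure (adelicUnipotent F E c 3))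
    (𝓕 : Set (adelicUnipotent F E c 3)) (f : (quasiSplit F E c 3).Adelic → ℂ) {T T' : ℝ≥0} (hTT' : T ≤ T')
    {x : (quasiSplit F E c 3).Adelic}
    (hx : ∀ γ : (quasiSplit F E c 3).arithmeticSubgroup,
      borelHeight ((γ : (quasiSplit F E c 3).Adelic) * x) ≤ T) :
    truncatedKernel ν 𝓕 T' f x - truncatedKernel ν 𝓕 T f x = 0 := by
  rw [truncatedKernel_eq_kernel_of_forall_le f hx,
    truncatedKernel_eq_kernel_of_forall_le f (fun γ => (hx γ).trans hTT'), sub_self]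

/-- **`k^{T'}(x) − k^{T}(x) = Σ_{δ ∈ B(F)\G(F)} 1_{T < H(δx) ≤ T'} K_B(δx, δx)`** for `1 ≤ T ≤ T'` and EVERY
`x ∈ U(J₃)(𝔸_F)` (every Haar measure `ν` of `N(𝔸_F)`, every fundamental domain `𝓕` of `N(F)`, every `f`):
the difference of two truncated kernels is the pseudo-Eisenstein series of the window — the identity
that, integrated over `G(F)\G(𝔸_F)` and unfolded, exhibits `J^{T'}(f) − J^T(f)` as an integral of `K_B`
over `B(F)\G(𝔸_F) ∩ {T < H ≤ T'}` (Arthur (1981), Prop. 2.3; Rogawski (1990), §2.1: `J^T` is a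
polynomial in `T`). [cite: Rogawski1990, §2.1 (p. 12)] [cite: Arthur1981TraceFormulaInvariantForm, Prop. 2.3] -/
theorem truncatedKernel_sub_truncatedKernel (ν : Measure (adelicUnipotent F E c 3)) [ν.IsHaarMeasure]
    {𝓕 : Set (adelicUnipotent F E c 3)} (h𝓕 : IsFundamentalDomain (rationalUnipotent F E c 3) 𝓕 ν)
    (f : (quasiSplit F E c 3).Adelic → ℂ) {T T' : ℝ≥0} (hT : 1 ≤ T) (hTT' : T ≤ T')
    (x : (quasiSplit F E c 3).Adelic) :
    truncatedKernel ν 𝓕 T' f x - truncatedKernel ν 𝓕 T f x =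
      pseudoEisenstein ({y : (quasiSplit F E c 3).Adelic | T < borelHeight y ∧ borelHeight y ≤ T'}.indicator
        (fun y => kernelBorel ν 𝓕 f y y)) x := by
  by_cases h : ∃ γ : (quasiSplit F E c 3).arithmeticSubgroup,
      T < borelHeight ((γ : (quasiSplit F E c 3).Adelic) * x)
  · obtain ⟨γ, hγ⟩ := h
    rw [truncatedKernel_sub_truncatedKernel_eq_of_lt ν h𝓕 f hT hTT' hγ,
      ← pseudoEisenstein_window_rational_mul ν h𝓕 f hTT' γ x,
      pseudoEisenstein_window_eq_self ν h𝓕 f hT hTT' hγ]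
  · simp only [not_exists, not_lt] at h
    rw [truncatedKernel_sub_truncatedKernel_eq_zero ν 𝓕 f hTT' h, pseudoEisenstein_window_eq_zero ν 𝓕 f h]

end Three

end UnitaryGroup

end Literature.NumberTheory.Automorphic
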